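import Literature.AlgebraicGeometry.Resolution.MacaulayficationKawasakiStepThree
import Literature.AlgebraicGeometry.Resolution.MacaulayficationKawasakiStepNine
import HarnessLib

/-!
# Kawasaki 2000, Theorem 3.1 (the interwoven induction assembled)

Topic: `Literature/AlgebraicGeometry/Resolution`. Brick of the proof of the named facts
`KawasakiMacaulayfication` / `CesnaviciusMacaulayfication`. This file assembles Steps 1–9 of the
printed proof of Kawasaki 2000, Thm. 3.1 (files `MacaulayficationKawasakiStepsOne` …
`MacaulayficationKawasakiStepNine`) into the theorem itself: for a `p`-standard system of parameters
`xs` of type `d - 1` (abstractly: `IsPStandard M xs`), all five statements `(A_ij)`–`(E_ij)` hold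
for all `i ≤ j < d` — "we shall prove them by induction on `j - i`".

* `IsPStandard.kawasakiAll31_self` — the case `i = j` (Steps 1–4);
* `IsPStandard.kawasaki31` — **Theorem 3.1**.

Everything is proved; no named fact is introduced.

## References

* [Kawasaki2000] T. Kawasaki, *On Macaulayfication of Noetherian schemes*, Trans. AMS 352 (2000)
  2517–2552, Thm. 3.1 and its proof (pp. 2523–2530).
* [Cesnavicius2021] K. Česnavičius, *Macaulayfication of Noetherian schemes*, Duke Math. J. 170
  (2021), Thm. 3.10 (KI-a,b,c) (the statements this induction feeds).
-/

namespace Literature.AlgebraicGeometry.Resolution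

open Ideal Submodule Module IsLocalRing
open scoped Pointwise

universe u v

variable {R : Type u} [CommRing R] [IsLocalRing R] [IsNoetherianRing R]
variable {M : Type v} [AddCommGroup M] [Module R M] [Module.Finite R M]

namespace IsPStandard

variable {xs : List R}

/-- **Kawasaki 2000, Thm. 3.1, the case `i = j`** (Steps 1, 2, 3, 4 of the printed proof):
`(A_ii)`, `(B_ii)`, `(C_ii)`, `(D_ii)`, `(E_ii)` hold for `i < d`.
[cite: Kawasaki2000, Thm. 3.1, Steps 1–4] -/
theorem kawasakiAll31_self (hx : IsPStandard M xs) {i : ℕ} (hi : i < xs.length) :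
    Kawasaki.All31 M xs i i :=
  have hA := hx.kawasakiA31_self i
  have hB := Kawasaki.b31_of_a31 hA
  ⟨hA, hB, Kawasaki.c31_self_of_b31 hB hi, Kawasaki.d31_self xs i,
    hx.kawasakiE31_self_of_b31 hB hi⟩

/-- **Kawasaki 2000, Theorem 3.1.** Let `xs = x₁,…,x_d` be a `p`-standard system of parameters
of type `d - 1` for `M` (abstractly: `IsPStandard M xs`, i.e. `xs ⊆ 𝔪` is a system of parameters
of `M` each of whose elements `xᵢ` kills the parameter colons of `M/(x_{i+1},…,x_d)M` — for a
genuine `p`-standard system this is Kawasaki's Lemma 2.5) and `qᵢ = (xᵢ,…,x_d)`. Then the five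
statements `(A_ij)`, `(B_ij)`, `(C_ij)`, `(D_ij)`, `(E_ij)` of [Kawasaki2000, Thm. 3.1]
(`Kawasaki.A31` … `Kawasaki.E31`, `0`-based) hold for all `i ≤ j < d`. Proof as printed: induction
on `j - i` through Steps 1–9. [cite: Kawasaki2000, Thm. 3.1] -/
theorem kawasaki31 (hx : IsPStandard M xs) {i j : ℕ} (hij : i ≤ j) (hj : j < xs.length) :
    Kawasaki.All31 M xs i j := by
  suffices key : ∀ g i j : ℕ, j = i + g → j < xs.length → Kawasaki.All31 M xs i j from
    key (j - i) i j (by omega) hj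
  intro g
  induction g with
  | zero =>
    intro i j hj hjd
    obtain rfl : j = i := by omega
    exact hx.kawasakiAll31_self hjd
  | succ g ih =>
    intro i j hj hjd
    have hij : i + 1 ≤ j := by omega
    have hi : i < xs.length := by omega
    obtain ⟨hA1, -, hC1, -, hE1⟩ := ih (i + 1) j (by omega) hjd
    obtain ⟨-, hBii, hCii, -, hEii⟩ := hx.kawasakiAll31_self hi
    -- Step 5, Step 2, Step 6, Step 7
    have hA := hx.kawasakiA31_of_succ hij hjd hA1 hC1
    have hB := Kawasaki.b31_of_a31 hA
    have hC := hx.kawasakiC31_of_succ hij hjd hB hCii hC1 hE1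
    have hD := hx.kawasakiD31_of_succ hij hC1
    refine ⟨hA, hB, hC, hD, ?_⟩
    -- Step 8 (`j = i + 1`) or Step 9 (`j > i + 1`)
    rcases Nat.eq_zero_or_pos g with rfl | hg
    · obtain rfl : j = i + 1 := by omega
      obtain ⟨-, -, -, -, hE1'⟩ := hx.kawasakiAll31_self hjd
      exact hx.kawasakiE31_succ hjd hB hEii hE1'
    · exact hx.kawasakiE31_of_lt (by omega) hjd hB hC1 hD hE1

end IsPStandard

end Literature.AlgebraicGeometry.Resolution
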